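import Summits.BirchSwinnertonDyer.Rank1Residual.X12.InertCoreUpperHalf
import Literature.NumberTheory.EllipticCurves.PastenValuationProductThm115Proofs
import Literature.NumberTheory.EllipticCurves.ComplexMultiplicationNotSemistable
import Literature.NumberTheory.EllipticCurves.TamagawaNeZeroProofs
import HarnessLib

/-!
# X12 inert-bad core, upper half: the Tamagawa binder `p ∤ ∏_ℓ c_ℓ(E)` DISCHARGED for CM at `p ≥ 5`

HONEST FRAMING (cell `b2b-bsdres`, run/shared/lean/b2b/bsd-rank1-residual/, verbatim in every
file): the goal of the cell is to DELETE the COMBINATION-SHAPED residual classes of the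
Birch–Swinnerton-Dyer formula for ALL analytic-rank `≤ 1` elliptic curves over `ℚ` — "full BSD
formula for every rank `≤ 1` curve in class `C`" assembled STRICTLY from published theorems — so
that the rank-`≤ 1` remainder becomes exactly the CONSTRUCTION-SHAPED classes, which are TYPED
(missing-input `Prop`s), NOT attempted. This is not "finishing BSD". Unit `b2b-bsdres-x1b` (X12
prover owner), generation 9; research route, no claim beyond the stated class; X12 REMAINS
CONSTRUCTION-SHAPED; nothing is booked.

Theorems only; no definition, no new named fact. Companion of `InertCoreUpperHalf.lean`, whose
class-level upper half carries the per-pair binder `htam : ¬ p ∣ ∏_ℓ c_ℓ(E)`. Here that binder is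
a THEOREM for every CM curve at every prime `p ≥ 5`: a CM curve over `ℚ` has NO prime of
multiplicative reduction (`j ∈ ℤ`; Silverman *ATAEC* II.6.4 / proof of II.10.5, tree
`not_hasMultiplicativeReductionAtPrime_of_hasCM`), so by Kodaira–Néron every local Tamagawa number
is `≤ 4` (Silverman *ATAEC* IV.9.2 (d), tree `localTamagawaNumber_padic_le_four_mul`), and
`∏_ℓ c_ℓ` — the finite product of these over the bad places (`tamagawaProduct_eq_prod`) — has no
prime factor `≥ 5` (`not_dvd_tamagawaProduct_of_hasCM`). The class-level statements of
`InertCoreUpperHalf.lean` are then restated WITHOUT `htam`: on the X12 pairs with `p ≥ 5`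
unramified in the CM field (the 72-pair inert-bad core and the split-bad corner), modulo ONLY the
Manin datum `p ∤ c(D)`, the upper half `MissingUpperBoundAt W p` holds from published facts, and
`BSD(E,p)` follows from the pair's own lower half `MissingLowerBoundAt W p`.
-/

noncomputable section

open scoped Classical NumberField

open WeierstrassCurve NumberField IsDedekindDomain Rat.HeightOneSpectrum
  Literature.NumberTheory.EllipticCurves
  Literature.NumberTheory.EllipticCurves.ModularForms
  Literature.NumberTheory.EllipticCurves.Rank1Residual
  Literature.NumberTheory.EllipticCurves.Rank1Residual.Typed
  Literature.NumberTheory.Automorphic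

namespace Summit.BirchSwinnertonDyer.Rank1Residual.X12

/-! ### §1 `p ≥ 5` never divides the Tamagawa product of a CM curve -/

/-- **Every local Tamagawa number of a CM curve over `ℚ` is `≤ 4`** (at the place `v` of `ℤ`, the
`p_v`-adic local Tamagawa number of `W/ℚ_{p_v}`): a CM curve has no multiplicative prime
(`not_hasMultiplicativeReductionAtPrime_of_hasCM`, transported to the place `v` by
`hasMultiplicativeReductionAtPrime_primesEquiv_iff_hasMultiplicativeReductionAt`), and off the
split multiplicative case Kodaira–Néron gives `c_v ≤ 4` (`localTamagawaNumber_padic_le_four_mul`).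
[cite: SilvermanATAEC1994, Cor. IV.9.2(d) (PDF p. 340); Thm. II.6.4 and proof of Thm. II.10.5] -/
theorem localTamagawaNumber_padic_le_four_of_hasCM (W : WeierstrassCurve ℚ) [W.IsElliptic]
    (hCM : W.HasCM) (v : HeightOneSpectrum ℤ) :
    (haveI := Fact.mk (primesEquiv v).2
     (W.baseChange ℚ_[primesEquiv v]).localTamagawaNumber ℤ_[primesEquiv v]) ≤ 4 := by
  haveI := Fact.mk (primesEquiv v).2
  have hnm : ¬ W.HasMultiplicativeReductionAt v := fun h ↦
    W.not_hasMultiplicativeReductionAtPrime_of_hasCM hCM (primesEquiv v)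
      ((hasMultiplicativeReductionAtPrime_primesEquiv_iff_hasMultiplicativeReductionAt W v).mpr h)
  have h4 := localTamagawaNumber_padic_le_four_mul W v
  rw [if_neg hnm, mul_one] at h4
  exact h4

/-- **`p ∤ ∏_ℓ c_ℓ(E)` for a CM curve `E/ℚ` and a prime `p ≥ 5`.** `∏_ℓ c_ℓ` is the finite
product of the local Tamagawa numbers over the bad places of `ℤ` (`tamagawaProduct_eq_prod`,
`finite_badPlaces_holds`); each factor is a positive integer (`localTamagawaNumber_padic_ne_zero_holds`,
Silverman *AEC* VII.6.2) and `≤ 4` (`localTamagawaNumber_padic_le_four_of_hasCM`), so a prime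
`p ≥ 5` divides none of them. This discharges, class-wide, the per-pair binder `htam` of the X12
upper half (harvest-1 g13 had certified it 72/72 on the core as data).
[cite: SilvermanATAEC1994, Cor. IV.9.2(d) (PDF p. 340)] [cite: SilvermanAEC2009, VII.6 Cor. 6.2] -/
theorem not_dvd_tamagawaProduct_of_hasCM (W : WeierstrassCurve ℚ) [W.IsElliptic] (hCM : W.HasCM)
    (p : ℕ) [Fact p.Prime] (hp5 : 5 ≤ p) : ¬ p ∣ W.tamagawaProduct := by
  have hp : p.Prime := Fact.out
  have hfin : (W.badPlaces ℤ).Finite := W.finite_badPlaces_holds ℤ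
  have hs : ∀ v, ¬ W.HasGoodReductionAt v → v ∈ hfin.toFinset := fun v hv ↦ by
    rw [Set.Finite.mem_toFinset, mem_badPlaces_iff]
    exact hv
  rw [tamagawaProduct_eq_prod W _ hs]
  intro hdvd
  obtain ⟨v, -, hv⟩ := (Prime.dvd_finsetProd_iff hp.prime _).mp hdvd
  haveI := Fact.mk (primesEquiv v).2
  haveI : (W.baseChange ℚ_[primesEquiv v]).IsElliptic := by
    unfold WeierstrassCurve.baseChange; infer_instance
  have h4 := localTamagawaNumber_padic_le_four_of_hasCM W hCM v
  have h0 : (W.baseChange ℚ_[primesEquiv v]).localTamagawaNumber ℤ_[primesEquiv v] ≠ 0 :=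
    localTamagawaNumber_padic_ne_zero_holds (primesEquiv v) _
  have hle : p ≤ (W.baseChange ℚ_[primesEquiv v]).localTamagawaNumber ℤ_[primesEquiv v] :=
    Nat.le_of_dvd (Nat.pos_of_ne_zero h0) hv
  omega

/-! ### §2 The X12 upper half and the lower-half-only residue WITHOUT the Tamagawa binder -/

/-- **Kolyvagin's inequality on the CM rank-one pairs at a bad unramified `p ≥ 5`, sharp form**:
`#Ш(E)_an = q ∈ ℚ` with `ord_p #Ш(E) ≤ ord_p q` — the Tamagawa defect of
`padicValNat_shaOrder_le_of_hasCM_rankOne_of_bad` vanishes for a CM curve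
(`not_dvd_tamagawaProduct_of_hasCM`). Binders as there (all PUBLISHED named facts; Manin datum
`p ∤ c(D)`). [cite: MatarNekovar2019, Thm. 0.3 and §0.11] [cite: BurungaleFlach2024, Thm. 1.1 and Cor. 2]
[cite: SilvermanATAEC1994, Cor. IV.9.2(d)] [cite: Miller2011LMS, Def. 1.1] -/
theorem missingUpperBoundAt_of_hasCM_rankOne_of_bad'
    (hGZ : ∀ (N : ℕ) [NeZero N] (W : WeierstrassCurve ℚ) (K : Type) [Field K] [NumberField K],
      gross_zagier N W K)
    (hKo : ∀ (N : ℕ) [NeZero N] (W : WeierstrassCurve ℚ) (K : Type) [Field K] [NumberField K],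
      kolyvagin N W K)
    (hMN : ∀ (N : ℕ) [NeZero N] (W : WeierstrassCurve ℚ) (K : Type) [Field K] [NumberField K],
      MatarNekovar2019.thm03_padicValNat_card_sha_le_of_irreducible N W K)
    (hGZK : rank_eq_analyticRank_of_analyticRank_le_one) (hmod : hasEntireLFunction_rat)
    (hnf : exists_isNewformOf) (hFH : friedbergHoffstein_exists_heegnerField_split_twist_ne_zero)
    (hCM8 : bsdTriple_of_hasCM_of_L_one_ne_zero)
    (W : WeierstrassCurve ℚ) [W.IsElliptic] [W.IsGloballyMinimal] (p : ℕ) [Fact p.Prime]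
    [NeZero (W.conductorNorm ℤ)]
    (hCM : W.HasCM) (hr : W.analyticRank = 1) (hp5 : 5 ≤ p) (hbad : ¬ Good W p)
    (hnr : ¬ CMRamified W p)
    (D : ModularParametrizationData W (W.conductorNorm ℤ)) (hc : ¬ (p : ℤ) ∣ D.c) :
    MissingUpperBoundAt W p :=
  missingUpperBoundAt_of_hasCM_rankOne_of_bad hGZ hKo hMN hGZK hmod hnf hFH hCM8 W p hCM hr hp5 hbad
    hnr D hc (not_dvd_tamagawaProduct_of_hasCM W hCM p hp5)

/-- **X12 ∧ `p ≥ 5` ∧ `p` unramified in the CM field: the UPPER half of `BSD(E,p)` from published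
facts, modulo ONLY the Manin datum `p ∤ c(D)`.** (The class clause forces `p ∣ N`; CM forces
`E[p]` irreducible and `p ∤ ∏c_ℓ`.) [cite: MatarNekovar2019, Thm. 0.3 and §0.11]
[cite: BurungaleFlach2024, Thm. 1.1 and Cor. 2] [cite: Miller2011LMS, Def. 1.1] -/
theorem missingUpperBoundAt_of_classX12_of_not_cmRamified'
    (hGZ : ∀ (N : ℕ) [NeZero N] (W : WeierstrassCurve ℚ) (K : Type) [Field K] [NumberField K],
      gross_zagier N W K)
    (hKo : ∀ (N : ℕ) [NeZero N] (W : WeierstrassCurve ℚ) (K : Type) [Field K] [NumberField K],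
      kolyvagin N W K)
    (hMN : ∀ (N : ℕ) [NeZero N] (W : WeierstrassCurve ℚ) (K : Type) [Field K] [NumberField K],
      MatarNekovar2019.thm03_padicValNat_card_sha_le_of_irreducible N W K)
    (hGZK : rank_eq_analyticRank_of_analyticRank_le_one) (hmod : hasEntireLFunction_rat)
    (hnf : exists_isNewformOf) (hFH : friedbergHoffstein_exists_heegnerField_split_twist_ne_zero)
    (hCM8 : bsdTriple_of_hasCM_of_L_one_ne_zero)
    (W : WeierstrassCurve ℚ) [W.IsElliptic] [W.IsGloballyMinimal] (p : ℕ) [Fact p.Prime]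
    [NeZero (W.conductorNorm ℤ)]
    (hX : ClassX12 W p) (hp5 : 5 ≤ p) (hnr : ¬ CMRamified W p)
    (D : ModularParametrizationData W (W.conductorNorm ℤ)) (hc : ¬ (p : ℤ) ∣ D.c) :
    MissingUpperBoundAt W p :=
  missingUpperBoundAt_of_classX12_of_not_cmRamified hGZ hKo hMN hGZK hmod hnf hFH hCM8 W p hX hp5 hnr
    D hc (not_dvd_tamagawaProduct_of_hasCM W hX.1 p hp5)

/-- **The typed residue of X12 on its unramified `p ≥ 5` part is the LOWER half, modulo only the
Manin datum**: `MissingLowerBoundAt W p → X12.MissingInputAt W p`. Consumer: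
`Typed.X12.bsdp_of_missingInputAt`. X12 stays CONSTRUCTION-SHAPED; nothing booked.
[cite: MatarNekovar2019, Thm. 0.3 and §0.11] [cite: Miller2011LMS, §1 and Def. 1.1] -/
theorem missingInputAt_of_classX12_of_not_cmRamified_of_lower'
    (hGZ : ∀ (N : ℕ) [NeZero N] (W : WeierstrassCurve ℚ) (K : Type) [Field K] [NumberField K],
      gross_zagier N W K)
    (hKo : ∀ (N : ℕ) [NeZero N] (W : WeierstrassCurve ℚ) (K : Type) [Field K] [NumberField K],
      kolyvagin N W K)
    (hMN : ∀ (N : ℕ) [NeZero N] (W : WeierstrassCurve ℚ) (K : Type) [Field K] [NumberField K],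
      MatarNekovar2019.thm03_padicValNat_card_sha_le_of_irreducible N W K)
    (hGZK : rank_eq_analyticRank_of_analyticRank_le_one) (hmod : hasEntireLFunction_rat)
    (hnf : exists_isNewformOf) (hFH : friedbergHoffstein_exists_heegnerField_split_twist_ne_zero)
    (hCM8 : bsdTriple_of_hasCM_of_L_one_ne_zero)
    (W : WeierstrassCurve ℚ) [W.IsElliptic] [W.IsGloballyMinimal] (p : ℕ) [Fact p.Prime]
    [NeZero (W.conductorNorm ℤ)]
    (hX : ClassX12 W p) (hp5 : 5 ≤ p) (hnr : ¬ CMRamified W p)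
    (D : ModularParametrizationData W (W.conductorNorm ℤ)) (hc : ¬ (p : ℤ) ∣ D.c)
    (hlowW : MissingLowerBoundAt W p) : X12.MissingInputAt W p :=
  missingInputAt_of_classX12_of_not_cmRamified_of_lower hGZ hKo hMN hGZK hmod hnf hFH hCM8 W p hX hp5
    hnr D hc (not_dvd_tamagawaProduct_of_hasCM W hX.1 p hp5) hlowW

/-- **`BSD(E,p)` on X12 ∧ `p ≥ 5` ∧ unramified from the pair's own LOWER half, modulo only the Manin
datum.** [cite: MatarNekovar2019, Thm. 0.3 and §0.11] [cite: Miller2011LMS, §1 and Def. 1.1] -/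
theorem bsdp_of_classX12_of_not_cmRamified_of_lower'
    (hGZ : ∀ (N : ℕ) [NeZero N] (W : WeierstrassCurve ℚ) (K : Type) [Field K] [NumberField K],
      gross_zagier N W K)
    (hKo : ∀ (N : ℕ) [NeZero N] (W : WeierstrassCurve ℚ) (K : Type) [Field K] [NumberField K],
      kolyvagin N W K)
    (hMN : ∀ (N : ℕ) [NeZero N] (W : WeierstrassCurve ℚ) (K : Type) [Field K] [NumberField K],
      MatarNekovar2019.thm03_padicValNat_card_sha_le_of_irreducible N W K)
    (hGZK : rank_eq_analyticRank_of_analyticRank_le_one) (hmod : hasEntireLFunction_rat)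
    (hnf : exists_isNewformOf) (hFH : friedbergHoffstein_exists_heegnerField_split_twist_ne_zero)
    (hCM8 : bsdTriple_of_hasCM_of_L_one_ne_zero)
    (W : WeierstrassCurve ℚ) [W.IsElliptic] [W.IsGloballyMinimal] (p : ℕ) [Fact p.Prime]
    [NeZero (W.conductorNorm ℤ)]
    (hX : ClassX12 W p) (hp5 : 5 ≤ p) (hnr : ¬ CMRamified W p)
    (D : ModularParametrizationData W (W.conductorNorm ℤ)) (hc : ¬ (p : ℤ) ∣ D.c)
    (hlowW : MissingLowerBoundAt W p) : BSDp W p :=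
  bsdp_of_classX12_of_not_cmRamified_of_lower hGZ hKo hMN hGZK hmod hnf hFH hCM8 W p hX hp5 hnr D hc
    (not_dvd_tamagawaProduct_of_hasCM W hX.1 p hp5) hlowW

end Summit.BirchSwinnertonDyer.Rank1Residual.X12

end
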